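import Summits.ResolutionOfSingularities.ResolutionOfSingularities.Theorems.EquisingularLiftEquisingularLiftNatTowerRuledDefs
import Literature.AlgebraicGeometry.Resolution.SpreadRestrict
import HarnessLib

/-!
# [OURS · L1 W4.5(b) · EL♮(3)] THE SPECIAL-FIBRE ISOMORPHISM: an isomorphism `V(J″) ≅ V(J)` of closed subschemes OVER a morphism of stages whose
# special fibres form a cartesian square restricts to an isomorphism of the traces `V(J″·𝒪_{G″}) ≅ V(J·𝒪_G)` over the downstairs map — the
# bridge that pushes a `DirStepSec` section down to the root of `DirLift.Ruled` (S6 (b)) and reads res-D-pv-051's `coneRound_centreIso` chain on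
# special fibres (the section isomorphism `δ` of `DirLift.ruled_round_root` at CONE rounds)

Crux chain w45b (cell `res-hironaka`, slot W4.5(b)), working crux **EL♮** = stmt-ResolutionOfSingularities-20038, child **EL♮(3)** =
stmt-ResolutionOfSingularities-20148, route EquisingularLift, line `sections`; rungs TOWER₃ / DIR₀₁, (round) clause. Written by res-L1-w45b-stub-2 g7
(STATUS 20:20:46Z: «KEEP `[IsIso δ]` … I supply the bridge»). HONEST FRAMING: OURS; NOT a statement of any manuscript; AI-written, weaker than expert
review. No `sorry`; standard axioms; DEF-FREE. `--supports stmt-ResolutionOfSingularities-20148 --as helper`.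

WHAT. `exists_isIso_subscheme_comap_of_iso_over`: for `π : X″ ⟶ X`, a CARTESIAN square of special fibres `jG″ ≫ π = ϖ ≫ jG`
(`IsPullback jG″ ϖ π jG` — from two model squares over `Spec θ` by res-D-pv-029's `isPullback_of_model_squares`), ideal sheaves `J″` on `X″`, `J` on `X`
and an isomorphism `e : V(J″) ≅ V(J)` with `e ≫ ι_J = ι_{J″} ≫ π`: an isomorphism `δ : V(J″·𝒪_{G″}) ⟶ V(J·𝒪_G)` with `δ ≫ ι = ι ≫ ϖ` (pullback
pasting `V(J″·𝒪_{G″}) = V(J″) ×_{X″} G″ = V(J″) ×_X G ≅ V(J) ×_X G = V(J·𝒪_G)`, tree `isPullback_subschemeMap`). `exists_isIso_redSub_of_iso_over`: the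
same read through exact reduced traces `J″·𝒪_{G″} = 𝓘⟨Z″⟩`, `J·𝒪_G = 𝓘⟨Z⟩` — an isomorphism `redSub G″ Z″ ⟶ redSub G Z` over `ϖ`.

References (index only): res-D-pv-029 `isPullback_of_model_squares` (…NatTowerCurveStep), res-D-pv-051 `coneRound_centreIso` (…NatConeRoundCentre l.79),
res-L1-w45b-stub-2 …NatTowerRuledDefs (R1′/R2) / …NatTowerRuledRoots (`ruled_round_root`'s `δ`). [cite: GortzWedhorn2020, Prop. 4.20] (fibre products; index).
-/

set_option linter.dupNamespace false -- mandated namespace `Summit.<Summit>.<Problem>` of this single-conjunct summit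

noncomputable section

open CategoryTheory CategoryTheory.Limits AlgebraicGeometry TopologicalSpace Topology
open Literature.AlgebraicGeometry.Resolution
open AlgebraicGeometry.Scheme.IdealSheafData

namespace Summit.ResolutionOfSingularities.ResolutionOfSingularities.Cruxes.EquisingularLiftNat.Sections

universe u

/-- **The special-fibre isomorphism, ideal-sheaf form.** See the module docstring. [cite: GortzWedhorn2020, Prop. 4.20] [OURS · L1 W4.5b · S6 (b)] -/
theorem exists_isIso_subscheme_comap_of_iso_over {X X'' G G'' : Scheme.{u}} (π : X'' ⟶ X) (jG : G ⟶ X) (jG'' : G'' ⟶ X'')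
    (ϖ : G'' ⟶ G) (hcart : IsPullback jG'' ϖ π jG) (J : X.IdealSheafData) (J'' : X''.IdealSheafData)
    (e : J''.subscheme ≅ J.subscheme) (he : e.hom ≫ J.subschemeι = J''.subschemeι ≫ π) :
    ∃ δ : (J''.comap jG'').subscheme ⟶ (J.comap jG).subscheme,
      δ ≫ (J.comap jG).subschemeι = (J''.comap jG'').subschemeι ≫ ϖ ∧ IsIso δ := by
  -- `V(J″·𝒪_{G″}) = V(J″) ×_{X″} G″ = V(J″) ×_X G` (pasting with the cartesian square of special fibres)
  have sJ'' := isPullback_subschemeMap jG'' J''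
  have Q : IsPullback ((J''.comap jG'').subschemeι ≫ ϖ) (subschemeMap (J''.comap jG'') J'' jG'' (J''.le_map_comap jG''))
      jG (J''.subschemeι ≫ π) := sJ''.flip.paste_horiz hcart.flip
  -- replace `V(J″)` by `V(J)` along `e`
  have Q' : IsPullback ((J''.comap jG'').subschemeι ≫ ϖ)
      (subschemeMap (J''.comap jG'') J'' jG'' (J''.le_map_comap jG'') ≫ e.hom) jG J.subschemeι :=
    Q.of_iso (Iso.refl _) (Iso.refl _) e (Iso.refl _) (by simp) (by simp) (by simp) (by rw [Iso.refl_hom, Category.comp_id, he])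
  -- `V(J·𝒪_G) = V(J) ×_X G`
  have sJ := (isPullback_subschemeMap jG J).flip
  refine ⟨(Q'.isoIsPullback _ _ sJ).hom, Q'.isoIsPullback_hom_fst _ _ sJ, inferInstance⟩

/-- **The special-fibre isomorphism of reduced traces.** With exact reduced traces `J″·𝒪_{G″} = 𝓘⟨Z″⟩` and `J·𝒪_G = 𝓘⟨Z⟩`, the
isomorphism `V(J″) ≅ V(J)` over `π` restricts to an isomorphism `redSub G″ Z″ ⟶ redSub G Z` over the downstairs map `ϖ` — the shape of
the section isomorphism `δ` consumed by `DirLift.ruled_round_root` / produced by `DirStepSec`, and of the push-down of a section to the root of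
`DirLift.Ruled`. [cite: GortzWedhorn2020, Prop. 4.20] [OURS · L1 W4.5b · S6 (b)] toward `stub_elnat_coneTowerPointResolution` /
`stub_elnat_ratDirZeroPointResolution` (stmt-ResolutionOfSingularities-20148); NOT a statement of the manuscript. -/
theorem exists_isIso_redSub_of_iso_over {X X'' G G'' : Scheme.{0}} (π : X'' ⟶ X) (jG : G ⟶ X) (jG'' : G'' ⟶ X'')
    (ϖ : G'' ⟶ G) (hcart : IsPullback jG'' ϖ π jG) (J : X.IdealSheafData) (J'' : X''.IdealSheafData)
    (e : J''.subscheme ≅ J.subscheme) (he : e.hom ≫ J.subschemeι = J''.subschemeι ≫ π)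
    {Z : Set G} (hZ : IsClosed Z) (hJ : J.comap jG = vanishingIdeal ⟨Z, hZ⟩)
    {Z'' : Set G''} (hZ'' : IsClosed Z'') (hJ'' : J''.comap jG'' = vanishingIdeal ⟨Z'', hZ''⟩) :
    ∃ δ : redSub G'' Z'' hZ'' ⟶ redSub G Z hZ, δ ≫ redSubι G Z hZ = redSubι G'' Z'' hZ'' ≫ ϖ ∧ IsIso δ := by
  have h := exists_isIso_subscheme_comap_of_iso_over π jG jG'' ϖ hcart J J'' e he
  rw [hJ, hJ''] at h
  exact h

end Summit.ResolutionOfSingularities.ResolutionOfSingularities.Cruxes.EquisingularLiftNat.Sections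

end
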